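import Summits.CriticalPhenomena.PercolationContinuityZ3.Theses.PercDebrisSweep
import Summits.CriticalPhenomena.PercolationContinuityZ3.Statement
import Summits.CriticalPhenomena.PercolationContinuityZ3.Theorems.PercDebrisSweepFiniteClusterVolumeTailStubNoArmSmallOfTheta
import Literature.Probability.Percolation.KestenZhangTailProofs
import Literature.Probability.Percolation.CriticalTwoArmsPersistence

/-!
# Birth skeleton (BC3) for the crux `FiniteClusterVolumeTail` (stmt-CriticalPhenomena-0943)

## LEAD VERDICT (prover-line-stmt-CriticalPhenomena-0943-0, 2026-08-17): LINE DEAD — the open stub is the summit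

* STUB 1 `stub_noArmSmallOfTheta`: LANDED (p147561,
  `Theorems/PercDebrisSweepFiniteClusterVolumeTailStubNoArmSmallOfTheta.lean`), wired in below.
* STUB 2 `stub_twoArmsSmallOfTheta`: PROVED EQUIVALENT TO `PercolationContinuityZ3` —
  `stub_twoArmsSmallOfTheta_iff_summit` at the end of this file, from
  `Literature.Probability.Percolation.KestenZhang.twoArms_small_of_theta_pos_iff`
  (`Literature/Probability/Percolation/CriticalTwoArmsPersistence.lean`, p149963; parts I–II
  p148451, p149370): if `θ(p_c) > 0` then `P_{p_c}(TwoArms N₀) ≥ ε` for ALL large `N₀`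
  (van den Berg–van Engelenburg 2022, proof of Lemma 6, run at the same density on these very
  blocks: far arm + ¬TwoArms is a local, 6-dependent, gluable good event; rarity at one scale would
  percolate slightly below `p_c` by continuity in `p`). Hence no reshape of clause (b) that still
  feeds the engine's `hq` survives, and the composition below closes the crux only vacuously.
  Dossier: `Lines/registered-dead.md`; barrier entry
  `Literature/Barriers/CriticalPhenomena/SameDensityLocalUniqueness.lean`.

Route `route-CriticalPhenomena-PercDebrisSweep` (sub-problem `PercolationContinuityZ3`), crux decl
`Summit.CriticalPhenomena.PercolationContinuityZ3.Theses.PercDebrisSweep.FiniteClusterVolumeTail`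
(rank 3 there; the item is SHARED by signature with `PercPorousCritical` (rank 2),
`PercQuarantineIslands` (rank 2) and `PercFoamCut` (rank 4)) — "K", Kesten–Zhang AT THE SAME `p`:
for every `p` with `θ(p) > 0` there is `c > 0` with `P_p(m ≤ |C(0)| < ∞) ≤ exp(-c m^{2/3})` for all
`m ≥ 1`. The event `{m ≤ |C(0)| < ∞}` is LITERALLY the tree's `KestenZhang.tailEvent 3 m`
(`crux_iff`, `Iff.rfl`).

THE LINE (Grimmett's own proof of Thm (8.65), pp. 222–223, run at the SAME density). The tree holds
the complete Kesten–Zhang renormalisation (`Literature/Probability/Percolation/KestenZhang*.lean`,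
sorry-free, `Grimmett1999_thm_8_65_holds`): blocks of side `2N₀+1`, the bad event of the origin block
`badAtOrigin N₀ = NoArm N₀ ∪ TwoArms N₀` (`KestenZhangBlocks.lean`), and the `p`-BLIND Peierls engine
`KestenZhang.real_tailEvent_le_exp`: at ANY `p`, if `P_p(badAtOrigin N₀) ≤ δ^{5^d}` at ONE scale `N₀`
(`δ = 1/(4(3^d+1)²)`), then `P_p(n ≤ |C| < ∞) ≤ K e^{-c n^{(d-1)/d}}` beyond `|B̃_0|`, and the small
sizes are absorbed by `P_p(n ≤ |C| < ∞) ≤ 1 - θ(p) < 1` (`exists_exp_bound_of_eventually`,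
`real_tailEvent_le_one_sub_theta`). In print (and in the tree) the smallness of the two clauses is
where `p > p_c` enters: clause (a) `real_NoArm_le` through GKZ 1993 Lemma 5 and clause (b)
`twoArms_small` through Lemma (7.78)/(7.95) (shell connections in face slabs) — both resting on the
Grimmett–Marstrand slab theorem, i.e. on a slab percolating AT `p`. The skeleton therefore cuts K
into the two clause-smallness statements AT THE SAME DENSITY, hypothesis `θ(p) > 0` only:

* STUB 1 `stub_noArmSmallOfTheta` (TRUE, PROVABLE NOW, M): **density alone makes clause (a) rare** —
  `θ(p) > 0 ⇒ P_p(NoArm N₀) → 0`. Sketch: on lattice configurations `NoArm N₀ ⊆ {B(N₀) ↮ ∞}`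
  (`KestenZhang.NoArm_inter_subset_noPercolation`, `GKZ.noPercolation (GM.ball 0 N₀)`,
  `ae_subset_edgeSet`), and `P_p(no vertex of S percolates) < η` as soon as `|S| ≥ m₀(p, η)`
  (`exists_card_le_imp_lt_real_exists_percolatesAt`, UniformPercolation.lean — needs only
  `θ(p) > 0`: `K` far-apart points, `(1-θ_R)^K + K(θ_R - θ)`), with `|B(N₀)| = (2N₀+1)³ → ∞`
  (`card_box`). No slab, no sprinkling. For `p > p_c` it is also the (exponential) tree theorem
  `KestenZhang.real_NoArm_le` (`noArmSmallOfTheta_supercrit` below, proved).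
* STUB 2 `stub_twoArmsSmallOfTheta` (OPEN — LOAD-BEARING): **local uniqueness at large scales from
  density alone** — `θ(p) > 0 ⇒ P_p(TwoArms N₀) → 0`, where `TwoArms N₀` asks for two vertices of the
  core `B(3N₀+1)` joined inside `B̃ = B(5N₀+2)` to `∂B̃` but not to each other inside `B̃`
  (Grimmett's clause (b), (8.90)). For `p > p_c` it is the tree theorem `KestenZhang.twoArms_small`
  (`twoArmsSmallOfTheta_supercrit` below, proved), so its whole content is the hypothetical
  percolating `p = p_c` — the live case of the crux, stated one level BELOW it (a block event, not a
  cluster-size law). Why it might fail: at `p_c` no slab percolates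
  (`theta_slab_criticalProbI_eq_zero`, DST 2016 in tree), so the printed route
  (7.78) ⇒ (7.95) ⇒ (7.89) is DEAD there — indeed its intermediate `real_inConn_shell_ge` (uniform
  shell connections `P_{p_c}(u ↔ v in shell r L) ≥ δ'`) is expected FALSE at `p_c` (strict slab
  subcriticality `p_c < p_c(S_L)`, Aizenman–Grimmett, plus sharpness in the slab `S_L`) —
  and a proof must glue two macroscopic clusters inside one box using `θ > 0` only; in a tame jump
  world (`φ(p_c) = 0`, Zhang 2000: `o(L²)` open cut-sets) such gluing is exactly what is in doubt.
  The barrier `Literature.Barriers.CriticalPhenomena.SprinklingRenormalisation` is met head-on HERE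
  and only here.

Composition (kernel-checked, no `sorry` outside the stubs): `tail_bound_of_clauses_small` re-runs
the tree's `tail_bound_of_twoArms_small` at `d = 3` with clause (a) supplied as a hypothesis instead
of `real_NoArm_le` (so that NO `p > p_c` is needed anywhere), and
`FiniteClusterVolumeTail_of : stub_noArmSmallOfTheta → stub_twoArmsSmallOfTheta → FiniteClusterVolumeTail`
(hypotheses typed by the name-keyed aliases `__Registered.stub_*`). Only the `p_c`-instances of the
stubs are load-bearing: `tail_bound_supercrit` (= `Grimmett1999_thm_8_65_holds.z3`, tree) covers
every `p > p_c`, `eq_criticalProbI_or_lt` is the regime split `θ(p) > 0 ⇒ p = p_c ∨ p_c < p`, and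
`tail_bound_of_critical_instances` assembles K's body from the tree theorem and the two
`p_c`-instances.

DISPROOF USED: none exists for this crux (`ledger crux ls stmt-CriticalPhenomena-0943`: no workfiles,
no `Disproof.lean`, no landed Negative lemma, 2026-08-17). Negatives index of the summit: no
statement about `tailEvent` / `NoArm` / `TwoArms`. Honest-piece check: STUB 1 is a theorem (sketch
above); STUB 2 ⊋ its `p > p_c` part (tree) and is NOT implied by K (K is a cluster-size law and says
nothing about two boundary-touching clusters of one box); STUB 1 + STUB 2 ⇒ K by the engine; the
dead sub-line (shell connections at `p_c`) is named so that no prover re-walks it.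
-/

noncomputable section

namespace Summit.CriticalPhenomena.PercolationContinuityZ3.Cruxes.FiniteClusterVolumeTail.Birth

open MeasureTheory Filter Literature.Probability.Percolation Literature.Probability.LatticeModels
open Summit.CriticalPhenomena.PercolationContinuityZ3.Theses.PercDebrisSweep (FiniteClusterVolumeTail)

/-! ## Objects of the line -/

/-- Bond percolation on `ℤ³` at density `p`. -/
abbrev μ (p : unitInterval) : Measure (BondConfig (Site 3)) := bondPercolation (zdGraph 3) p

/-- The crux is literally `∀ p, θ(p) > 0 → ∃ c > 0, ∀ m ≥ 1, P_p(tailEvent 3 m) ≤ exp(-c m^{2/3})`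
with the tree's `KestenZhang.tailEvent 3 m = {m ≤ |C(0)| < ∞}`. -/
theorem crux_iff :
    FiniteClusterVolumeTail ↔
      ∀ p : unitInterval, 0 < theta (zdGraph 3) (0 : Site 3) p → ∃ c : ℝ, 0 < c ∧ ∀ m : ℕ, 1 ≤ m →
        (μ p).real (KestenZhang.tailEvent 3 m) ≤ Real.exp (-(c * (m : ℝ) ^ ((2 : ℝ) / 3))) :=
  Iff.rfl

/-- Smallness at large scales of a block event, in the `ε`–`N₁` form consumed by the tree's engine
(`KestenZhang.tail_bound_of_twoArms_small`). -/
def SmallAtLargeScales (p : unitInterval) (E : ℕ → Set (BondConfig (Site 3))) : Prop :=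
  ∀ ε : ℝ, 0 < ε → ∃ N₁ : ℕ, ∀ N₀ : ℕ, N₁ ≤ N₀ → (μ p).real (E N₀) ≤ ε

/-! ## The two stub statements -/

/-- STUB 1 statement (clause (a) from density alone): for every `p` with `θ(p) > 0`,
`P_p(NoArm N₀) → 0` — no vertex of the origin block `B(N₀)` is joined to `∂B(5N₀+2)` inside
`B(5N₀+2)` becomes rare as `N₀ → ∞`. -/
def NoArmSmallOfTheta : Prop :=
  ∀ p : unitInterval, 0 < theta (zdGraph 3) (0 : Site 3) p →
    ∀ ε : ℝ, 0 < ε → ∃ N₁ : ℕ, ∀ N₀ : ℕ, N₁ ≤ N₀ →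
      (bondPercolation (zdGraph 3) p).real (KestenZhang.NoArm (d := 3) N₀) ≤ ε

/-- STUB 2 statement (clause (b) from density alone = local uniqueness at large scales): for every
`p` with `θ(p) > 0`, `P_p(TwoArms N₀) → 0` — two vertices of the core `B(3N₀+1)` joined inside
`B̃ = B(5N₀+2)` to `∂B̃` but not to each other inside `B̃` becomes rare as `N₀ → ∞`. -/
def TwoArmsSmallOfTheta : Prop :=
  ∀ p : unitInterval, 0 < theta (zdGraph 3) (0 : Site 3) p →
    ∀ ε : ℝ, 0 < ε → ∃ N₁ : ℕ, ∀ N₀ : ℕ, N₁ ≤ N₀ →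
      (bondPercolation (zdGraph 3) p).real (KestenZhang.TwoArms (d := 3) N₀) ≤ ε

/-! ## Registered stubs -/

/-- **STUB 1 `noArmSmallOfTheta`** (TRUE, PROVABLE NOW; M): `θ(p) > 0 ⇒ P_p(NoArm N₀) → 0`.
Proof plan: `P_p`-a.s. `ω ⊆ E(ℤ³)` (`ae_subset_edgeSet`), and on such `ω`,
`NoArm N₀ ⊆ GKZ.noPercolation (GM.ball 0 N₀)` (`KestenZhang.NoArm_inter_subset_noPercolation`:
a percolating vertex of `B(N₀)` exits `B(5N₀+2)` through `∂B(5N₀+2)`); then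
`P_p(∀ z ∈ S, z ↮ ∞) = 1 - P_p(∃ z ∈ S, z ↔ ∞) < η` once `|S| ≥ m₀(p, η)`
(`exists_card_le_imp_lt_real_exists_percolatesAt`, which needs only `θ(p) > 0`), and
`|B(N₀)| = (2N₀+1)³ ≥ m₀` for `N₀` large (`card_box`). Grimmett 1999 p. 223: "Since `θ(p) > 0`,
`P_p(B_x ↔ ∞) → 1` as `N → ∞`" — the printed argument, minus the exponential rate (which the engine
does not need). For `p > p_c`: `noArmSmallOfTheta_supercrit` (proved below from `real_NoArm_le`). -/
theorem stub_noArmSmallOfTheta :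
    ∀ p : unitInterval, 0 < theta (zdGraph 3) (0 : Site 3) p →
      ∀ ε : ℝ, 0 < ε → ∃ N₁ : ℕ, ∀ N₀ : ℕ, N₁ ≤ N₀ →
        (bondPercolation (zdGraph 3) p).real (KestenZhang.NoArm N₀) ≤ ε :=
  -- LANDED (wave 1, p147561): `Theorems/PercDebrisSweepFiniteClusterVolumeTailStubNoArmSmallOfTheta.lean`
  Summit.CriticalPhenomena.PercolationContinuityZ3.Theorems.FiniteClusterVolumeTail.stub_noArmSmallOfTheta

/-- **STUB 2 `twoArmsSmallOfTheta`** (OPEN — LOAD-BEARING): `θ(p) > 0 ⇒ P_p(TwoArms N₀) → 0`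
(Grimmett 1999 (8.90), clause (b): local uniqueness of the block construction at large scales).
For `p > p_c` it is the tree theorem `KestenZhang.twoArms_small` (`twoArmsSmallOfTheta_supercrit`),
so the content is the hypothetical percolating `p = p_c`. Why it might fail: the printed proof
(Lemma (7.78) seeds in face slabs ⇒ (7.95) shell connections ⇒ (7.89) peeling) needs a slab
percolating AT `p`, and none does at `p_c` (`theta_slab_criticalProbI_eq_zero`, DST 2016) — its
intermediate `KestenZhang.real_inConn_shell_ge` is expected false at `p_c` (strict slab subcriticality
plus sharpness in the slab); a same-density proof must
glue two box-crossing clusters using `θ > 0` alone, which a tame jump world (`φ(p_c) = 0`,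
Zhang 2000; `o(L²)` open cut-sets around `B(L)`) is designed to defeat. Barrier
`Literature.Barriers.CriticalPhenomena.SprinklingRenormalisation`: head-on, here only. -/
theorem stub_twoArmsSmallOfTheta :
    ∀ p : unitInterval, 0 < theta (zdGraph 3) (0 : Site 3) p →
      ∀ ε : ℝ, 0 < ε → ∃ N₁ : ℕ, ∀ N₀ : ℕ, N₁ ≤ N₀ →
        (bondPercolation (zdGraph 3) p).real (KestenZhang.TwoArms N₀) ≤ ε := by
  sorry

/-- The registered stub `stub_noArmSmallOfTheta` is stated UNFOLDED (so that a `Theorems/` file, which cannot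
import this crux workfile, can prove the identical signature); it is definitionally the statement
`NoArmSmallOfTheta`. -/
example : NoArmSmallOfTheta := stub_noArmSmallOfTheta

/-- Likewise `stub_twoArmsSmallOfTheta` is definitionally `TwoArmsSmallOfTheta`. -/
example : TwoArmsSmallOfTheta := stub_twoArmsSmallOfTheta

/-! ### Name-keyed aliases of the stub statements
`__Registered.stub_X` is statement `X` under the registered stub's short name, so that the native
skeleton audit (`#h21_check_skeleton`: hypotheses admissible iff registered obligations / declared
stubs BY NAME) accepts `FiniteClusterVolumeTail_of : __Registered.stub_… → … → FiniteClusterVolumeTail`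
(device of `Cruxes/BGNOffTheFloor/Lines/birth.lean`; the `@[stub]` attribute is gate-reserved). -/
namespace __Registered

/-- Alias of `NoArmSmallOfTheta` keyed by the registered stub name. -/
abbrev stub_noArmSmallOfTheta : Prop := NoArmSmallOfTheta
/-- Alias of `TwoArmsSmallOfTheta` keyed by the registered stub name. -/
abbrev stub_twoArmsSmallOfTheta : Prop := TwoArmsSmallOfTheta

end __Registered

/-! ## The engine at the same density (proved) -/

/-- **Theorem (8.65) at the SAME `p`, given both clauses small.** For bond percolation on `ℤ³`
and any `p` with `θ(p) > 0`: if `P_p(NoArm N₀) → 0` and `P_p(TwoArms N₀) → 0`, then there is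
`c > 0` with `P_p(m ≤ |C(0)| < ∞) ≤ exp(-c m^{2/3})` for all `m ≥ 1`. This is the tree's
`KestenZhang.tail_bound_of_twoArms_small` at `d = 3` with clause (a) fed as a hypothesis in place of
`real_NoArm_le` — so no `p > p_c` appears: `badAtOrigin N₀ = NoArm ∪ TwoArms` has probability
`≤ δ^{125}`, `δ = 1/3136`, at one common large scale; the `p`-blind Peierls engine
`KestenZhang.real_tailEvent_le_exp` gives `K e^{-c n^{2/3}}` beyond `|B(5N₀+2)|`; small `n` are
absorbed by `P_p(n ≤ |C| < ∞) ≤ 1 - θ(p) < 1` (`exists_exp_bound_of_eventually`). -/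
theorem tail_bound_of_clauses_small (p : unitInterval) (hθ : 0 < theta (zdGraph 3) (0 : Site 3) p)
    (hNo : SmallAtLargeScales p fun N₀ => KestenZhang.NoArm (d := 3) N₀)
    (hLU : SmallAtLargeScales p fun N₀ => KestenZhang.TwoArms (d := 3) N₀) :
    ∃ c : ℝ, 0 < c ∧ ∀ m : ℕ, 1 ≤ m →
      (μ p).real (KestenZhang.tailEvent 3 m) ≤ Real.exp (-(c * (m : ℝ) ^ ((2 : ℝ) / 3))) := by
  -- the target `δ`, making `ρ = 1/2` in the Peierls sum
  set δ : ℝ := 1 / (4 * (3 ^ 3 + 1 : ℝ) ^ 2) with hδ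
  have hδ0 : 0 < δ := by positivity
  have hδ1 : δ ≤ 1 := by rw [hδ]; norm_num
  have hρ : 2 * (3 ^ 3 + 1 : ℝ) ^ 2 * δ ≤ 1 / 2 := by rw [hδ]; norm_num
  set ε₀ : ℝ := δ ^ 5 ^ 3 with hε₀
  have hε₀0 : 0 < ε₀ := by positivity
  -- clause (a) and clause (b) at a common large scale `N₀`
  obtain ⟨Na, hNa⟩ := hNo (ε₀ / 2) (by positivity)
  obtain ⟨Nb, hNb⟩ := hLU (ε₀ / 2) (by positivity)
  set N₀ : ℕ := max Na Nb with hN₀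
  have hq : (μ p).real (KestenZhang.badAtOrigin (d := 3) N₀) ≤ δ ^ 5 ^ 3 := by
    calc (μ p).real (KestenZhang.badAtOrigin (d := 3) N₀)
        ≤ (μ p).real (KestenZhang.NoArm (d := 3) N₀) + (μ p).real (KestenZhang.TwoArms (d := 3) N₀) :=
          measureReal_union_le _ _
      _ ≤ ε₀ / 2 + ε₀ / 2 := add_le_add (hNa N₀ (le_max_left _ _)) (hNb N₀ (le_max_right _ _))
      _ = δ ^ 5 ^ 3 := by rw [hε₀]; ring
  -- the `p`-blind Peierls engine of the tree
  obtain ⟨K, c, hc, hK⟩ := KestenZhang.real_tailEvent_le_exp (d := 3) (by norm_num) p N₀ hδ0 hδ1 hq hρ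
  -- absorb the prefactor and the small sizes using `θ(p) > 0`
  have hθ1 : 1 - theta (zdGraph 3) (0 : Site 3) p < 1 := by linarith
  obtain ⟨η, hη, hall⟩ := KestenZhang.exists_exp_bound_of_eventually
    (f := fun n => (μ p).real (KestenZhang.tailEvent 3 n)) (by norm_num) hθ1 hc
    (KestenZhang.real_tailEvent_le_one_sub_theta (d := 3) p)
    (n₁ := (KestenZhang.bigBox 3 N₀).card + 1) fun n hn => hK n (by omega)
  refine ⟨η, hη, fun m _ => ?_⟩
  have h23 : (((3 : ℕ) : ℝ) - 1) / ((3 : ℕ) : ℝ) = (2 : ℝ) / 3 := by norm_num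
  have := hall m
  rw [h23] at this
  exact this

/-! ## The composition, by name -/

/-- **`FiniteClusterVolumeTail_of`**: the two registered stubs imply the crux
`Summit.CriticalPhenomena.PercolationContinuityZ3.Theses.PercDebrisSweep.FiniteClusterVolumeTail`
(kernel-checked; no `sorry` outside the stubs): at each `p` with `θ(p) > 0`, feed the two clauses at
that `p` to the same-density engine `tail_bound_of_clauses_small`. -/
theorem FiniteClusterVolumeTail_of (hLU : __Registered.stub_twoArmsSmallOfTheta) :
    Summit.CriticalPhenomena.PercolationContinuityZ3.Theses.PercDebrisSweep.FiniteClusterVolumeTail := by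
  intro p hθ
  -- clause (a) is the LANDED stub `stub_noArmSmallOfTheta` (p147561); clause (b) is the open stub
  exact tail_bound_of_clauses_small p hθ (stub_noArmSmallOfTheta p hθ) (hLU p hθ)

/-- Wiring check: the registered stub feeds `FiniteClusterVolumeTail_of` as stated. -/
example : Summit.CriticalPhenomena.PercolationContinuityZ3.Theses.PercDebrisSweep.FiniteClusterVolumeTail :=
  FiniteClusterVolumeTail_of stub_twoArmsSmallOfTheta

/-! ## Proved plumbing: only the `p_c`-instances of the stubs are load-bearing -/

/-- `θ(p) > 0 ⇒ p_c ≤ p` (`p_c = inf ({p | θ(p) > 0} ∪ {1})`, Grimmett 1999 (1.11); no coupling needed). -/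
theorem criticalProb_le_of_theta_pos' {p : unitInterval} (h : 0 < theta (zdGraph 3) (0 : Site 3) p) :
    criticalProb (zdGraph 3) (0 : Site 3) ≤ (p : ℝ) := by
  refine csInf_le ⟨0, ?_⟩ (Or.inl ⟨p.2, by simpa using h⟩)
  rintro r (⟨hr, -⟩ | hr)
  · exact hr.1
  · rw [Set.mem_singleton_iff] at hr
    rw [hr]; exact zero_le_one

/-- The regime split: a percolating `p` is either the critical point itself or strictly supercritical. -/
theorem eq_criticalProbI_or_lt {p : unitInterval} (h : 0 < theta (zdGraph 3) (0 : Site 3) p) :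
    p = criticalProbI 3 ∨ criticalProb (zdGraph 3) (0 : Site 3) < (p : ℝ) := by
  rcases (criticalProb_le_of_theta_pos' h).eq_or_lt with heq | hlt
  · exact Or.inl (Subtype.ext (by rw [coe_criticalProbI]; exact heq.symm))
  · exact Or.inr hlt

/-- The supercritical regime is a THEOREM of the tree: Kesten–Zhang 1990 = Grimmett 1999 Thm (8.65),
`Grimmett1999_thm_8_65_holds` (sorry-free renormalisation, `KestenZhangTailProofs.lean`). -/
theorem tail_bound_supercrit (p : unitInterval) (hp : criticalProb (zdGraph 3) (0 : Site 3) < (p : ℝ)) :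
    ∃ c : ℝ, 0 < c ∧ ∀ m : ℕ, 1 ≤ m →
      (μ p).real (KestenZhang.tailEvent 3 m) ≤ Real.exp (-(c * (m : ℝ) ^ ((2 : ℝ) / 3))) :=
  Grimmett1999_thm_8_65_holds.z3 p hp

/-- STUB 1 on `p > p_c` is the tree's exponential bound `KestenZhang.real_NoArm_le` (GKZ 1993
Lemma 5 via Grimmett–Marstrand), weakened to `→ 0`. -/
theorem noArmSmallOfTheta_supercrit (p : unitInterval) (hp : criticalProb (zdGraph 3) (0 : Site 3) < (p : ℝ)) :
    SmallAtLargeScales p fun N₀ => KestenZhang.NoArm (d := 3) N₀ := by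
  obtain ⟨γ, hγ, hNoArm⟩ := KestenZhang.real_NoArm_le (d := 3) (by norm_num) p hp
  intro ε hε
  have ht : Tendsto (fun N₀ : ℕ => Real.exp (-(γ * N₀))) atTop (nhds 0) := by
    refine Real.tendsto_exp_atBot.comp ?_
    refine tendsto_neg_atTop_atBot.comp ?_
    exact Tendsto.const_mul_atTop hγ tendsto_natCast_atTop_atTop
  obtain ⟨N₁, hN₁⟩ := eventually_atTop.1 (ht.eventually (ge_mem_nhds hε))
  exact ⟨N₁, fun N₀ h => (hNoArm N₀).trans (hN₁ N₀ h)⟩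

/-- STUB 2 on `p > p_c` is the tree theorem `KestenZhang.twoArms_small` (Lemma (7.89) peeling on
(7.95)/(7.78), Grimmett–Marstrand). -/
theorem twoArmsSmallOfTheta_supercrit (p : unitInterval) (hp : criticalProb (zdGraph 3) (0 : Site 3) < (p : ℝ)) :
    SmallAtLargeScales p fun N₀ => KestenZhang.TwoArms (d := 3) N₀ :=
  KestenZhang.twoArms_small (d := 3) (by norm_num) p hp

/-- **Only the `p_c`-instances are load-bearing.** K's body at every percolating `p` follows from
the tree theorem on `p > p_c` and the two stub instances AT `p_c` (hypothesis `θ(p_c) > 0` — the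
jump world). Stated on the unfolded body (not the crux name) so that `FiniteClusterVolumeTail_of`
stays the unique skeleton theorem. -/
theorem tail_bound_of_critical_instances
    (hNo : 0 < theta (zdGraph 3) (0 : Site 3) (criticalProbI 3) →
      SmallAtLargeScales (criticalProbI 3) fun N₀ => KestenZhang.NoArm (d := 3) N₀)
    (hLU : 0 < theta (zdGraph 3) (0 : Site 3) (criticalProbI 3) →
      SmallAtLargeScales (criticalProbI 3) fun N₀ => KestenZhang.TwoArms (d := 3) N₀) :
    ∀ p : unitInterval, 0 < theta (zdGraph 3) (0 : Site 3) p → ∃ c : ℝ, 0 < c ∧ ∀ m : ℕ, 1 ≤ m →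
      (μ p).real (KestenZhang.tailEvent 3 m) ≤ Real.exp (-(c * (m : ℝ) ^ ((2 : ℝ) / 3))) := by
  intro p hθ
  rcases eq_criticalProbI_or_lt hθ with rfl | hlt
  · exact tail_bound_of_clauses_small _ hθ (hNo hθ) (hLU hθ)
  · exact tail_bound_supercrit p hlt

/-- Conversely the stubs' `p > p_c` parts are settled, so the stubs are EQUIVALENT to their
`p_c`-instances (given the tree): the line's open content is exactly clause (a) [provable] and
clause (b) [open] at a percolating `p_c`. -/
theorem twoArmsSmallOfTheta_iff_critical :
    TwoArmsSmallOfTheta ↔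
      (0 < theta (zdGraph 3) (0 : Site 3) (criticalProbI 3) →
        SmallAtLargeScales (criticalProbI 3) fun N₀ => KestenZhang.TwoArms (d := 3) N₀) := by
  constructor
  · exact fun h hθ => h _ hθ
  · intro h p hθ
    rcases eq_criticalProbI_or_lt hθ with rfl | hlt
    · exact h hθ
    · exact twoArmsSmallOfTheta_supercrit p hlt

theorem noArmSmallOfTheta_iff_critical :
    NoArmSmallOfTheta ↔
      (0 < theta (zdGraph 3) (0 : Site 3) (criticalProbI 3) →
        SmallAtLargeScales (criticalProbI 3) fun N₀ => KestenZhang.NoArm (d := 3) N₀) := by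
  constructor
  · exact fun h hθ => h _ hθ
  · intro h p hθ
    rcases eq_criticalProbI_or_lt hθ with rfl | hlt
    · exact h hθ
    · exact noArmSmallOfTheta_supercrit p hlt

/-! ## Lead verdict, kernel-checked: the open stub is the summit -/

/-- **STUB 2 ⟺ the summit conjunct.** `TwoArmsSmallOfTheta` (the statement of the registered
stub `stub_twoArmsSmallOfTheta`) holds if and only if `θ(p_c(ℤ³)) = 0`
(`PercolationContinuityZ3`): van den Berg–van Engelenburg's same-density renormalisation
(`KestenZhang.twoArms_small_of_theta_pos_iff`). So the only sorry of this skeleton cannot be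
discharged short of the summit. -/
theorem stub_twoArmsSmallOfTheta_iff_summit : TwoArmsSmallOfTheta ↔ _root_.PercolationContinuityZ3 :=
  KestenZhang.twoArms_small_of_theta_pos_iff (d := 3) le_rfl

/-- **In the jump world the engine's input fails at every large scale**: if `θ(p_c) > 0` then
`P_{p_c}(TwoArms N₀) ≥ ε > 0` for all `N₀ ≥ N₁`, so `hq : P_{p_c}(badAtOrigin N₀) ≤ δ^{125}`
(`badAtOrigin ⊇ TwoArms`) is false for every `N₀ ≥ N₁`. -/
theorem le_real_twoArms_of_jump (hθ : 0 < theta (zdGraph 3) (0 : Site 3) (criticalProbI 3)) :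
    ∃ ε : ℝ, 0 < ε ∧ ∃ N₁ : ℕ, ∀ N₀ : ℕ, N₁ ≤ N₀ →
      ε ≤ (μ (criticalProbI 3)).real (KestenZhang.TwoArms (d := 3) N₀) :=
  KestenZhang.exists_le_real_TwoArms_of_theta_pos (d := 3) (by norm_num) hθ

end Summit.CriticalPhenomena.PercolationContinuityZ3.Cruxes.FiniteClusterVolumeTail.Birth

end
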